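import Summits.CriticalPhenomena.PercolationContinuityZ3.Theorems.PercNearOneGluingNoHeavyLowerTailQuantitativeCovDIsolatedFloor
import HarnessLib

/-!
# The COMPARABLE case of the upper half of BENCH row M2-R50 (row M2-R51):
# `covD(g·χ_u; u) ≤ μ(D) · Cov_{w_Y}((g·χ_u)(𝒞_x), 1{x↔u})`

Support file (`--supports stmt-CriticalPhenomena-4575`), prover seat `prim-rate-mine-2` (lane prim-rate, constants-miner (c), BENCH row
M2-R51; `run/shared/lean/prim/prim-rate/prim-rate-mine-2/PROOFS.md` §P51).  No definitions, no named facts, no sorries; standard axioms.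

Row M2-R50 compared the conditioned vdBHK covariance `CSH.covD w x Y f u = μ(D)·∫_{D∩{x↔u}} f(𝒞_x) − (∫_D f(𝒞_x))·μ(D∩{x↔u})`,
`D = {x ↮ Y}` (`= μ(D)²·Cov(f(𝒞_x), 1{x↔u} | D)`), with the ISOLATED covariance `Cov_{w_Y}(f(𝒞_x), 1{x↔u})` (`w_Y` = `w` zeroed on the
pairs meeting `Y`).  The LOWER half `μ(D)·∏_{e∩Y≠∅}(1−w_e)·Cov_{w_Y} ≤ covD` is the theorem `CSH.covD_ge_isolated`; the UPPER half
`covD ≤ μ(D)·Cov_{w_Y}` is FALSE for a general monotone `f` (BENCH l.172 / l.174: exact 5-vertex witnesses with `f = 1{b ∈ V(𝒞_x)}`, `b ≠ u`).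
THIS FILE proves the upper half on the COMPARABLE family `f = g · χ_u`, `χ_u = connIndicatorFn x u = 1{u ∈ V(𝒞_x)}`, `g` monotone `≥ 0`
(every monotone `f ≥ 0` that is constant on `{u ∉ V(𝒞_x)}` has this form up to an additive constant, under which both sides are invariant):
* `CSH.openEdgeCluster_sdiff_pairsAt_eq` — on `D` the open edge cluster of `x` does not see the pairs meeting `Y`;
* **`CSH.covD_mul_conn_le_isolated`** — for ANY weights in `[0,1]`, any `Y`, `x`, `u` and any `g` monotone `≥ 0` on edge clusters:
  `covD w x Y (g·χ_u) u ≤ μ(D) · (∫_{x↔u} (g·χ_u)(𝒞_x) dμ_{w_Y} − (∫ (g·χ_u)(𝒞_x) dμ_{w_Y}) · μ_{w_Y}(x↔u))`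
  (literally the bracket of `CSH.covD_ge_isolated`, so the two files give the two-sided sandwich on this family; on the diagonal `g = 1`:
  `h_min·μ(D)·Var_{w_Y}(1{x↔u}) ≤ covD(χ_u; u) = μ(D∩{x↔u})·μ(D∖{x↔u}) ≤ μ(D)·Var_{w_Y}(1{x↔u})`).
Proof.  With `A = {x↔u}`: `covD(g·χ_u) = (∫_{D∩A} g(𝒞_x) dμ)·μ(D∖A)` and the bracket is `(∫_A g(𝒞_x) dμ_{w_Y})·μ_{w_Y}(Aᶜ)`.  On `D` the
integrand `(g·χ_u)(𝒞_x(ω))` equals the INCREASING function `ω ↦ (g·χ_u)(𝒞_x(ω ∖ E_Y))` (`E_Y` = pairs meeting `Y`), so Harris' inequality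
for `prodBernoulli w` (the decreasing `1_D` against it; `QuantHarris.influence_mul_influence_le_cov_prodBernoulli`) and the deletion identity
`∫ F(ω∖E_Y) dμ_w = ∫ F dμ_{w_Y}` (`BHK2006.integral_comp_sdiff_prodBernoulli'`) give `∫_{D∩A} g ≤ μ(D)·∫_A g dμ_{w_Y}`, while
`D∖A ⊆ {ω : ω∖E_Y ∉ A}` gives `μ(D∖A) ≤ μ_{w_Y}(Aᶜ)`.
[cite: Harris1960, Lemma 4.1 (p. 16)] [cite: VandenbergHaggstromKahn2005, Thm. 1.3 (p. 6), §2.1 Lemma 2.3 (p. 10)]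
-/

noncomputable section

namespace Summit.CriticalPhenomena.PercolationContinuityZ3.Theorems.CSH

open MeasureTheory Set unitInterval
open Literature.Probability.LatticeModels (prodBernoulli)
open Literature.Probability.Percolation
open Literature.Probability.Percolation.BHK2006 (openEdgeCluster_mono openEdgeCluster_eq_of_agree)
open scoped Classical

variable {V : Type*} [Fintype V]

/-! ### Harris' inequality, functional form -/

/-- Harris' inequality for two nonnegative monotone functions of the configuration under `prodBernoulli w` (read off the
influence-product floor `QuantHarris.influence_mul_influence_le_cov_prodBernoulli`, whose left side is `≥ 0`). [cite: Harris1960, Lemma 4.1 (p. 16)] -/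
private theorem integral_mul_integral_le_integral_mul₄ (w : Sym2 V → unitInterval) (e0 : Sym2 V) (F G : Set (Sym2 V) → ℝ)
    (hF0 : ∀ ω, 0 ≤ F ω) (hG0 : ∀ ω, 0 ≤ G ω) (hF : Monotone F) (hG : Monotone G) :
    (∫ ω, F ω ∂(prodBernoulli w)) * (∫ ω, G ω ∂(prodBernoulli w)) ≤ ∫ ω, F ω * G ω ∂(prodBernoulli w) := by
  have h := QuantHarris.influence_mul_influence_le_cov_prodBernoulli w e0 F G hF0 hG0 hF hG
  have hl : 0 ≤ (w e0 : ℝ) * (1 - w e0) *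
      ((∫ ω, (F (insert e0 ω) - F (ω \ {e0})) ∂(prodBernoulli w)) *
        ∫ ω, (G (insert e0 ω) - G (ω \ {e0})) ∂(prodBernoulli w)) := by
    refine mul_nonneg (mul_nonneg (w e0).2.1 (sub_nonneg.2 (w e0).2.2)) (mul_nonneg ?_ ?_)
    · exact integral_nonneg fun ω => sub_nonneg.2 (hF (Set.sdiff_subset.trans (Set.subset_insert e0 ω)))
    · exact integral_nonneg fun ω => sub_nonneg.2 (hG (Set.sdiff_subset.trans (Set.subset_insert e0 ω)))
  linarith

/-- `∫ 1_S · F = ∫_S F`. [folklore] -/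
private theorem integral_indicator_one_mul₄ (μ : Measure (BondConfig V)) (S : Set (BondConfig V)) (F : BondConfig V → ℝ) :
    ∫ ω, S.indicator 1 ω * F ω ∂μ = ∫ ω in S, F ω ∂μ := by
  have hS : MeasurableSet S := MeasurableSet.of_discrete
  have e : (fun ω => S.indicator (1 : BondConfig V → ℝ) ω * F ω) = S.indicator F := by
    funext ω
    by_cases hω : ω ∈ S
    · rw [Set.indicator_of_mem hω, Set.indicator_of_mem hω, Pi.one_apply, one_mul]
    · rw [Set.indicator_of_notMem hω, Set.indicator_of_notMem hω, zero_mul]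
  rw [e, integral_indicator hS]

/-! ### On `D = {x ↮ Y}` the cluster of `x` does not see the pairs meeting `Y` -/

omit [Fintype V] in
/-- **On `D = {x ↮ Y}` the open edge cluster of `x` does not see the pairs meeting `Y`**: deleting every pair that meets `Y` does not
change `𝒞_x(ω)` when no `y ∈ Y` is reachable from `x` (an open pair of the cluster meeting `Y` would reach `Y`). [folklore] -/
theorem openEdgeCluster_sdiff_pairsAt_eq {ω : BondConfig V} {x : V} {Y : Set V}
    (hω : ∀ y ∈ Y, ¬ (openGraph ω).Reachable x y) :
    openEdgeCluster (ω \ {e | ∃ y ∈ Y, y ∈ e}) x = openEdgeCluster ω x := by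
  refine openEdgeCluster_eq_of_agree (fun e he => ?_) rfl
  refine ⟨fun heω => ⟨heω, ?_⟩, fun h => h.1⟩
  rintro ⟨y, hy, hye⟩
  obtain ⟨v, hve, hv⟩ := he
  have hxv : (openGraph ω).Reachable x v := (reachable_iff_exists_mem_openEdgeCluster ω x v).2 hv
  by_cases hvy : v = y
  · exact hω y hy (hvy ▸ hxv)
  · have hevy : e = s(v, y) := (Sym2.mem_and_mem_iff hvy).1 ⟨hve, hye⟩
    exact hω y hy (hxv.trans ((openGraph_adj ω v y).2 ⟨hevy ▸ heω, hvy⟩).reachable)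

/-! ### The comparable case of the upper half of row M2-R50 -/

/-- **Row M2-R51 — the upper half of the M2-R50 sandwich on the comparable family `f = g · χ_u`.**  ANY weights in `[0,1]`, any `Y`,
`x`, `u`, any `g` monotone and nonnegative on edge clusters; `w_Y` = `w` zeroed on the pairs meeting `Y`, `D = {x ↮ Y}`:
`covD w x Y (g·χ_u) u ≤ μ(D) · (∫_{x↔u} (g·χ_u)(𝒞_x) dμ_{w_Y} − (∫ (g·χ_u)(𝒞_x) dμ_{w_Y}) · μ_{w_Y}(x↔u))` — the upper companion of
`CSH.covD_ge_isolated` (which needs no comparability).  For a general monotone `f` in place of `g·χ_u` the inequality is false (BENCH l.174).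
[cite: Harris1960, Lemma 4.1 (p. 16)] [cite: VandenbergHaggstromKahn2005, Thm. 1.3 (p. 6), §2.1 Lemma 2.3 (p. 10)] -/
theorem covD_mul_conn_le_isolated (w : Sym2 V → unitInterval) (x : V) (Y : Set V) (u : V)
    (g : Set (Sym2 V) → ℝ) (hg : Monotone g) (hg0 : ∀ C, 0 ≤ g C) :
    covD w x Y (fun C => g C * connIndicatorFn x u C) u ≤
      (prodBernoulli w).real {ω : BondConfig V | ∀ y ∈ Y, ¬ (openGraph ω).Reachable x y} *
        ((∫ η in openConn x u, g (openEdgeCluster η x) * connIndicatorFn x u (openEdgeCluster η x)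
            ∂(prodBernoulli fun e => if (∃ y ∈ Y, y ∈ e) then (0 : unitInterval) else w e)) -
          (∫ η, g (openEdgeCluster η x) * connIndicatorFn x u (openEdgeCluster η x)
              ∂(prodBernoulli fun e => if (∃ y ∈ Y, y ∈ e) then (0 : unitInterval) else w e)) *
            (prodBernoulli fun e => if (∃ y ∈ Y, y ∈ e) then (0 : unitInterval) else w e).real (openConn x u)) := by
  set μ := prodBernoulli w with hμ
  set D : Set (BondConfig V) := {ω | ∀ y ∈ Y, ¬ (openGraph ω).Reachable x y} with hD
  set A : Set (BondConfig V) := openConn x u with hA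
  set M : Set (Sym2 V) := {e | ∃ y ∈ Y, y ∈ e} with hM
  set wY : Sym2 V → unitInterval := fun e => if (∃ y ∈ Y, y ∈ e) then (0 : unitInterval) else w e with hwY
  set ν := prodBernoulli wY with hν
  -- the integrand `F(ω) = (g·χ_u)(𝒞_x(ω))` and its `Y`-deleted version
  set F : BondConfig V → ℝ := fun ω => g (openEdgeCluster ω x) * connIndicatorFn x u (openEdgeCluster ω x) with hF
  set FY : BondConfig V → ℝ := fun ω => F (ω \ M) with hFY
  have hmeas : ∀ S : Set (BondConfig V), MeasurableSet S := fun _ => MeasurableSet.of_discrete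
  have hM0 : ∀ e ∈ M, wY e = 0 := fun e he => by simp only [hwY]; exact if_pos he
  have hM1 : ∀ e ∉ M, wY e = w e := fun e he => by simp only [hwY]; exact if_neg he
  -- `F = g(𝒞_x) · 1_A`, `F ≥ 0`, `F = 0` off `A`, `F` monotone
  have hFA : ∀ ω, F ω = g (openEdgeCluster ω x) * A.indicator 1 ω := fun ω => by
    simp only [hF, hA, connIndicatorFn_openEdgeCluster]
  have hF0 : ∀ ω, 0 ≤ F ω := fun ω => by
    rw [hFA]; exact mul_nonneg (hg0 _) (Set.indicator_nonneg (fun _ _ => zero_le_one) ω)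
  have hFoff : ∀ ω ∉ A, F ω = 0 := fun ω hω => by rw [hFA, Set.indicator_of_notMem hω, mul_zero]
  have hχ0 : ∀ C : Set (Sym2 V), 0 ≤ connIndicatorFn x u C := fun C => by
    unfold connIndicatorFn; split_ifs; exacts [zero_le_one, le_rfl]
  have hFmono : Monotone F := fun ω ω' h =>
    mul_le_mul (hg (openEdgeCluster_mono h x)) (monotone_connIndicatorFn x u (openEdgeCluster_mono h x)) (hχ0 _) (hg0 _)
  have hFYmono : Monotone FY := fun ω ω' h => hFmono (Set.sdiff_subset_sdiff_left h)
  have hFY0 : ∀ ω, 0 ≤ FY ω := fun ω => hF0 _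
  -- on `D`, `F = FY` (the cluster does not see the pairs meeting `Y`)
  have hFD : ∀ ω ∈ D, F ω = FY ω := fun ω hω => by
    simp only [hFY, hF, hM, openEdgeCluster_sdiff_pairsAt_eq hω]
  -- Step 0: the two sides in product form
  set Iμ : ℝ := ∫ ω in D ∩ A, F ω ∂μ with hIdef
  set Jν : ℝ := ∫ η in A, F η ∂ν with hJdef
  have hID : ∫ ω in D, F ω ∂μ = Iμ :=
    setIntegral_eq_of_subset_of_forall_sdiff_eq_zero (hmeas D) Set.inter_subset_left
      (fun ω hω => hFoff ω (fun hA' => hω.2 ⟨hω.1, hA'⟩))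
  have hJν : ∫ η, F η ∂ν = Jν := (setIntegral_eq_integral_of_forall_compl_eq_zero (fun η hη => hFoff η hη)).symm
  have hcov : covD w x Y (fun C => g C * connIndicatorFn x u C) u =
      μ.real D * Iμ - (∫ ω in D, F ω ∂μ) * μ.real (D ∩ A) := rfl
  have hDsplit : μ.real (D ∩ A) + μ.real (D \ A) = μ.real D := measureReal_inter_add_sdiff (hmeas A)
  have hcov' : covD w x Y (fun C => g C * connIndicatorFn x u C) u = Iμ * μ.real (D \ A) := by
    rw [hcov, hID, ← hDsplit]; ring
  have hνsplit : ν.real A + ν.real Aᶜ = 1 := by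
    rw [← probReal_univ (μ := ν), ← Set.union_compl_self A]
    exact (measureReal_union disjoint_compl_right (hmeas Aᶜ)).symm
  have hrhs : (∫ η in A, F η ∂ν) - (∫ η, F η ∂ν) * ν.real A = Jν * ν.real Aᶜ := by
    rw [hJν]
    have : ν.real Aᶜ = 1 - ν.real A := by linarith
    rw [this]; ring
  -- Step 1 (Harris + deletion): `Iμ ≤ μ(D) · Jν`
  have hI_le : Iμ ≤ μ.real D * Jν := by
    have hIFY : Iμ = ∫ ω in D, FY ω ∂μ := by
      rw [← hID]; exact setIntegral_congr_fun (hmeas D) (fun ω hω => hFD ω hω)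
    have hsplit : ∫ ω in D, FY ω ∂μ + ∫ ω in Dᶜ, FY ω ∂μ = ∫ ω, FY ω ∂μ :=
      integral_add_compl (hmeas D) (Integrable.of_finite)
    -- Harris for the increasing `1_{Dᶜ}` and the increasing `FY`
    have hDc_mono : Monotone (Dᶜ.indicator (1 : BondConfig V → ℝ)) := by
      intro ω ω' hle
      by_cases h : ω ∈ Dᶜ
      · have h' : ω' ∈ Dᶜ := by
          simp only [hD, Set.mem_compl_iff, Set.mem_setOf_eq, not_forall, not_not] at h ⊢
          obtain ⟨y, hy, hr⟩ := h
          exact ⟨y, hy, hr.mono (openGraph_mono hle)⟩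
        rw [Set.indicator_of_mem h, Set.indicator_of_mem h']
        exact le_rfl
      · rw [Set.indicator_of_notMem h]; exact Set.indicator_nonneg (fun _ _ => zero_le_one) _
    obtain ⟨e0⟩ : Nonempty (Sym2 V) := ⟨s(x, x)⟩
    have hH := integral_mul_integral_le_integral_mul₄ w e0 (Dᶜ.indicator (1 : BondConfig V → ℝ)) FY
      (fun ω => Set.indicator_nonneg (fun _ _ => zero_le_one) ω) hFY0 hDc_mono hFYmono
    rw [integral_indicator_one_mul₄, integral_indicator_one (hmeas Dᶜ)] at hH
    rw [← hμ] at hH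
    have hDc : μ.real Dᶜ = 1 - μ.real D := by
      have h1 : μ.real D + μ.real Dᶜ = 1 := by
        rw [← probReal_univ (μ := μ), ← Set.union_compl_self D]
        exact (measureReal_union disjoint_compl_right (hmeas Dᶜ)).symm
      linarith
    have hdel : ∫ ω, FY ω ∂μ = Jν := by
      rw [← hJν]; exact BHK2006.integral_comp_sdiff_prodBernoulli' w wY M hM0 hM1 F
    rw [hDc, hdel] at hH
    rw [hIFY]
    linarith [hsplit, hH]
  -- Step 2: `μ(D ∖ A) ≤ μ_{w_Y}(Aᶜ)`
  have hDA_le : μ.real (D \ A) ≤ ν.real Aᶜ := by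
    have hsub : D \ A ⊆ {ω : BondConfig V | ω \ M ∈ Aᶜ} := fun ω hω hωM =>
      hω.2 (isUpperSet_openConn x u Set.sdiff_subset hωM)
    have hpre : μ.real {ω : BondConfig V | ω \ M ∈ Aᶜ} = ν.real Aᶜ := by
      rw [← integral_indicator_one (hmeas _), ← integral_indicator_one (hmeas Aᶜ),
        ← BHK2006.integral_comp_sdiff_prodBernoulli' w wY M hM0 hM1 (Aᶜ.indicator 1)]
      refine integral_congr_ae (Filter.Eventually.of_forall fun ω => ?_)
      by_cases hω : ω \ M ∈ Aᶜ
      · have h1 : ω ∈ {ω : BondConfig V | ω \ M ∈ Aᶜ} := hω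
        simp only [Set.indicator_of_mem h1, Set.indicator_of_mem hω, Pi.one_apply]
      · have h1 : ω ∉ {ω : BondConfig V | ω \ M ∈ Aᶜ} := hω
        simp only [Set.indicator_of_notMem h1, Set.indicator_of_notMem hω]
    rw [← hpre]
    exact measureReal_mono hsub
  -- Step 3: multiply
  have hI0 : 0 ≤ Iμ := setIntegral_nonneg (hmeas _) fun ω _ => hF0 ω
  have hJ0 : 0 ≤ Jν := setIntegral_nonneg (hmeas _) fun ω _ => hF0 ω
  rw [hcov', hrhs]
  calc Iμ * μ.real (D \ A) ≤ (μ.real D * Jν) * ν.real Aᶜ :=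
        mul_le_mul hI_le hDA_le measureReal_nonneg (mul_nonneg measureReal_nonneg hJ0)
    _ = μ.real D * (Jν * ν.real Aᶜ) := by ring

/-! ### The diagonal `f = χ_u`: `covD(χ_u; u) = μ(D ∩ {x↔u}) · μ(D ∖ {x↔u}) ≤ μ(D) · Var_{w_Y}(1{x↔u})` -/

/-- **The diagonal of the conditioned covariance is a product**: `covD(χ_u; u) = μ(D ∩ {x↔u}) · μ(D ∖ {x↔u})`, `D = {x ↮ Y}`. [folklore] -/
theorem covD_conn_eq_real_mul_real (w : Sym2 V → unitInterval) (x : V) (Y : Set V) (u : V) :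
    covD w x Y (connIndicatorFn x u) u =
      (prodBernoulli w).real ({ω : BondConfig V | ∀ y ∈ Y, ¬ (openGraph ω).Reachable x y} ∩ openConn x u) *
        (prodBernoulli w).real ({ω : BondConfig V | ∀ y ∈ Y, ¬ (openGraph ω).Reachable x y} \ openConn x u) := by
  set μ := prodBernoulli w with hμ
  set D : Set (BondConfig V) := {ω | ∀ y ∈ Y, ¬ (openGraph ω).Reachable x y} with hD
  set A : Set (BondConfig V) := openConn x u with hA
  have hmeas : ∀ S : Set (BondConfig V), MeasurableSet S := fun _ => MeasurableSet.of_discrete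
  have h1 : ∫ ω in D ∩ A, connIndicatorFn x u (openEdgeCluster ω x) ∂μ = μ.real (D ∩ A) := by
    simp only [connIndicatorFn_openEdgeCluster]
    rw [setIntegral_indicator (hmeas _), Set.inter_assoc, Set.inter_self]
    simp only [Pi.one_apply, setIntegral_const, smul_eq_mul, mul_one]
  have h2 : ∫ ω in D, connIndicatorFn x u (openEdgeCluster ω x) ∂μ = μ.real (D ∩ A) := by
    simp only [connIndicatorFn_openEdgeCluster]
    rw [setIntegral_indicator (hmeas _)]
    simp only [Pi.one_apply, setIntegral_const, smul_eq_mul, mul_one]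
    rfl
  have hcov : covD w x Y (connIndicatorFn x u) u =
      μ.real D * (∫ ω in D ∩ A, connIndicatorFn x u (openEdgeCluster ω x) ∂μ) -
        (∫ ω in D, connIndicatorFn x u (openEdgeCluster ω x) ∂μ) * μ.real (D ∩ A) := rfl
  have hDsplit : μ.real (D ∩ A) + μ.real (D \ A) = μ.real D := measureReal_inter_add_sdiff (hmeas A)
  rw [hcov, h1, h2, ← hDsplit]; ring

/-- **The diagonal of the M2-R50 sandwich, upper side**: `covD(χ_u; u) ≤ μ(D) · μ_{w_Y}(x↔u) · (1 − μ_{w_Y}(x↔u))` (`= μ(D)·Var_{w_Y}(1{x↔u})`),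
ANY weights, any `Y`, `x`, `u`; with `CSH.covD_ge_isolated` (`f = χ_u`): `∏_{e∩Y≠∅}(1−w_e)·μ(D)·Var_{w_Y} ≤ covD(χ_u; u) ≤ μ(D)·Var_{w_Y}`.
[cite: Harris1960, Lemma 4.1 (p. 16)] [cite: VandenbergHaggstromKahn2005, Thm. 1.3 (p. 6), §2.1 Lemma 2.3 (p. 10)] -/
theorem covD_conn_le_isolated_variance (w : Sym2 V → unitInterval) (x : V) (Y : Set V) (u : V) :
    covD w x Y (connIndicatorFn x u) u ≤
      (prodBernoulli w).real {ω : BondConfig V | ∀ y ∈ Y, ¬ (openGraph ω).Reachable x y} *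
        ((prodBernoulli fun e => if (∃ y ∈ Y, y ∈ e) then (0 : unitInterval) else w e).real (openConn x u) *
          (1 - (prodBernoulli fun e => if (∃ y ∈ Y, y ∈ e) then (0 : unitInterval) else w e).real (openConn x u))) := by
  set wY : Sym2 V → unitInterval := fun e => if (∃ y ∈ Y, y ∈ e) then (0 : unitInterval) else w e with hwY
  set ν := prodBernoulli wY with hν
  set A : Set (BondConfig V) := openConn x u with hA
  have hmeas : ∀ S : Set (BondConfig V), MeasurableSet S := fun _ => MeasurableSet.of_discrete
  have h := covD_mul_conn_le_isolated w x Y u (fun _ => (1 : ℝ)) monotone_const (fun _ => zero_le_one)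
  have h1 : ∫ η in A, (1 : ℝ) * connIndicatorFn x u (openEdgeCluster η x) ∂ν = ν.real A := by
    simp only [one_mul, connIndicatorFn_openEdgeCluster]
    rw [setIntegral_indicator (hmeas _), Set.inter_self]
    simp only [Pi.one_apply, setIntegral_const, smul_eq_mul, mul_one]
  have h2 : ∫ η, (1 : ℝ) * connIndicatorFn x u (openEdgeCluster η x) ∂ν = ν.real A := by
    simp only [one_mul, connIndicatorFn_openEdgeCluster]
    rw [integral_indicator_one (hmeas _)]
  rw [h1, h2] at h
  calc covD w x Y (connIndicatorFn x u) u = covD w x Y (fun C => (1 : ℝ) * connIndicatorFn x u C) u := by simp only [one_mul]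
    _ ≤ _ := h
    _ = _ := by ring

end Summit.CriticalPhenomena.PercolationContinuityZ3.Theorems.CSH

end
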